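import Summits.QuantumFields.YangMills.Theorems.ParabolicTrajectoryLatticeGapOnTrajectorySparseDefectCoreDefs
import Summits.QuantumFields.YangMills.Theorems.ParabolicTrajectoryLatticeGapOnTrajectoryStubSparseUnderOfLargeField
import Summits.QuantumFields.YangMills.Theorems.ParabolicTrajectoryLatticeGapOnTrajectoryStubLargeFieldCountEvent
import Summits.QuantumFields.YangMills.Theorems.ParabolicTrajectoryLatticeGapOnTrajectoryLargeFieldSparse
import HarnessLib

/-!
# Crux `LatticeGapOnTrajectory` (stmt-QuantumFields-10523), line `sparse-defect-orbit-window`: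
# the physics core in FAMILY form — joint sparseness under Wilson's measure peeled off
# (lead c8, second reshape, 2026-08-17)

Route-posited objects (D-0016 `<Route><Crux>…Defs` file, `--supports stmt-QuantumFields-10523`).
Nothing about mass gaps is asserted: `TypicalCoreFamiliesAlongP` is the statement of the registered
physics stub `stub_typicalCoreFamilies` (open; Sub₁ strength); everything else is G-blind and proved.

The physics core `TypicalCoreAlongP` (CoreDefs p141179) asks, on every torus and frame family the
crux visits, for SOME good cell events with measurability, cell-locality, the Dobrushin–Shlosman
contraction on good shells, the received-sum condition, hereditary sparseness under the window
kernels AND joint sparseness `SparseUnder` under Wilson's torus measure, with `ε_k (1 + A_k) → 0`.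
For good events of FAMILY TYPE — cell `x` is good iff none of `J` prescribed plaquette families
`P x j` (each of at least `m` plaquettes, all four links of every plaquette inside the cell `x`) is
entirely `ε₀`-large, `familyGood r ε₀ P x` — three of these are free:
* measurability and cell-locality (`measurableSet_familyGood`, `familyGood_local`, from the landed
  stub (M) `stub_largeFieldCountEvent`'s lemmas `measurableSet_largeField`,
  `plaquetteHolonomy_congr_of_cell`, p140797);
* `SparseUnder μ_{β_k} (familyGood …) (J_k e^{−c β_k m_k})` from LARGE-FIELD SPARSENESS
  (`largeFieldSparse`, p139523, every compact `G`) by the union-bound stub (U)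
  `stub_sparseUnderOfLargeField` (p140953) — families of distinct cells are disjoint because their
  plaquettes are based in distinct cells.
Family type covers the intended instances: COUNT events ("fewer than `m` plaquettes of energy
`≥ ε₀` in every sub-block of the cell": families = `m`-subsets of sub-block plaquette sets) and, by
the covering `Σ_B s_p ≥ E ⇒ #{p ∈ B : s_p ≥ E/(2|B|)} ≥ E/(4N)`, sub-block ENERGY events. Lead c8's
boundary-forcing remark (NOTES §Physics audit): shell data good at a level just below `ε₀` force, as
`β → ∞`, interior plaquettes of the first layers to energies of order `ε₀` (disagreeing fixed staples
at window edges/corners), at most `O(ℓ³)` per sub-block of side `ℓ`; hereditary sparseness of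
family/count events is therefore only plausible with VOLUME-PROPORTIONAL thresholds `m ≍ c ℓ⁴`
(equivalently energy-density events), not with `m ≍ log D_k` — the format below leaves `J_k, m_k`
and the families to the physics stub and records the resulting rate condition
`∀ c > 0, J_k e^{−c β_k m_k} (1 + A_k) → 0`.

* §1 monotonicity of the two sparseness notions in the level; `L_k → ∞` for every scheme.
* §2 `familyGood` and its measurability / locality / cover form.
* §3 `TypicalCoreFamiliesAlongP` (statement of `stub_typicalCoreFamilies`) and the kernel-checked
  composition `typicalCoreAlongP_of_families : TypicalCoreFamiliesAlongP ⇒ TypicalCoreAlongP` along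
  every scheme with `β_k → ∞` (uses `largeFieldSparse` + (U) + (M); unconditional otherwise).
-/

set_option autoImplicit false

noncomputable section

namespace Summit.QuantumFields.YangMills.Cruxes.LatticeGapOnTrajectory.SparseDefectOrbitWindow

open scoped BigOperators Topology ENNReal ProbabilityTheory
open Filter MeasureTheory
open Literature.Probability.LatticeModels (Specification IsSpecification IsGibbsMeasure glueWith)
open Literature.MathematicalPhysics.QuantumFieldTheory
open Summit.QuantumFields.YangMills.Theses.ParabolicTrajectory
open Summit.QuantumFields.YangMills.Cruxes.LatticeGapOnTrajectory.OrbitKantorovichFiniteSize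

/-! ## §1 Monotonicity in the sparseness level; the torus sides of a scheme diverge -/

section Mono

variable {μ : Fin 4 → ℕ} {V S : Type} [Fintype V] [MeasurableSpace S]

omit [Fintype V] in
/-- Joint sparseness under a state is monotone in the level: `ε ≤ ε'` (with `0 ≤ ε`). -/
theorem SparseUnder.mono {ν : Measure (V → S)} {good : CoarseIdx μ → Set (V → S)} {ε ε' : ℝ}
    (h : SparseUnder ν good ε) (h0 : 0 ≤ ε) (hle : ε ≤ ε') : SparseUnder ν good ε' :=
  fun X => (h X).trans (ENNReal.ofReal_le_ofReal (pow_le_pow_left₀ h0 hle _))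

/-- Hereditary sparseness under the window kernels is monotone in the level. -/
theorem HereditarySparse.mono {cell : V → CoarseIdx μ} {γ : Specification V S} {n : ℕ}
    {good : CoarseIdx μ → Set (V → S)} {ε ε' : ℝ} (h : HereditarySparse cell γ n good ε)
    (h0 : 0 ≤ ε) (hle : ε ≤ ε') : HereditarySparse cell γ n good ε' :=
  fun c ω hω X hX => (h c ω hω X hX).trans (ENNReal.ofReal_le_ofReal (pow_le_pow_left₀ h0 hle _))

end Mono

/-- **The torus half-sides of a scheme diverge**: `a_k L_k → ∞` with `a_k → 0⁺` forces `L_k → ∞`. -/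
theorem tendsto_L_atTop {ι : Type} (sch : SpeciesScheme ι) : Tendsto sch.L atTop atTop := by
  have ha : ∀ᶠ k in atTop, sch.a k ≤ 1 :=
    (sch.tendsto_a.eventually (gt_mem_nhds one_pos)).mono fun k hk => hk.le
  have hreal : Tendsto (fun k => (sch.L k : ℝ)) atTop atTop := by
    refine tendsto_atTop_mono' atTop ?_ sch.tendsto_L
    filter_upwards [ha] with k hk
    have hL : (0 : ℝ) ≤ sch.L k := Nat.cast_nonneg _
    calc sch.a k * sch.L k ≤ 1 * sch.L k := mul_le_mul_of_nonneg_right hk hL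
      _ = sch.L k := one_mul _
  exact tendsto_natCast_atTop_iff.1 hreal

/-! ## §2 Good events of family type -/

section Family

variable {G : Type} [Group G] [TopologicalSpace G] [IsTopologicalGroup G] [CompactSpace G]
  [MeasurableSpace G] [BorelSpace G]

/-- **Good events of family type** (`familyGood r ε₀ P x`): the cell `x` is GOOD in the configuration
`U` iff none of the prescribed plaquette families `P x j`, `j : Fin J`, is entirely `ε₀`-large, i.e.
every family contains a plaquette of energy `N − Re tr r(U_p) < ε₀`. (Count events "fewer than `m`
large plaquettes in every sub-block" are the case `P x ·` = the `m`-subsets of the sub-blocks of `x`.) -/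
def familyGood (r : LatticeRep G) (ε₀ : ℝ) {N : ℕ} {μ : Fin 4 → ℕ} {J : ℕ}
    (P : CoarseIdx μ → Fin J → Finset (Plaquette 4 N)) (x : CoarseIdx μ) : Set (GaugeConfig 4 N G) :=
  {U | ∀ j : Fin J, ∃ p ∈ P x j,
    (r.N : ℝ) - (r.ρ (plaquetteHolonomy U p.1 p.2.1.1 p.2.1.2)).trace.re < ε₀}

omit [IsTopologicalGroup G] [CompactSpace G] [MeasurableSpace G] [BorelSpace G] in
/-- Cover form: a configuration is BAD on `x` iff some prescribed family of `x` is entirely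
`ε₀`-large (the cover hypothesis of the union-bound stub (U)). -/
theorem not_mem_familyGood_iff (r : LatticeRep G) (ε₀ : ℝ) {N : ℕ} {μ : Fin 4 → ℕ} {J : ℕ}
    (P : CoarseIdx μ → Fin J → Finset (Plaquette 4 N)) (x : CoarseIdx μ) (U : GaugeConfig 4 N G) :
    U ∉ familyGood r ε₀ P x ↔ ∃ j : Fin J, ∀ p ∈ P x j,
      ε₀ ≤ (r.N : ℝ) - (r.ρ (plaquetteHolonomy U p.1 p.2.1.1 p.2.1.2)).trace.re := by
  simp only [familyGood, Set.mem_setOf_eq, not_forall, not_exists, not_and, not_lt]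

/-- Family-type good events are measurable (finite Boolean combination of one-plaquette
large-field events, `StubLargeFieldCountEvent.measurableSet_largeField`). -/
theorem measurableSet_familyGood (r : LatticeRep G) (ε₀ : ℝ) {N : ℕ} {μ : Fin 4 → ℕ} {J : ℕ}
    (P : CoarseIdx μ → Fin J → Finset (Plaquette 4 N)) (x : CoarseIdx μ) :
    MeasurableSet (familyGood r ε₀ P x) := by
  have hset : familyGood r ε₀ P x = ⋂ j : Fin J, ⋃ p ∈ P x j, {U : GaugeConfig 4 N G |
      ε₀ ≤ (r.N : ℝ) - (r.ρ (plaquetteHolonomy U p.1 p.2.1.1 p.2.1.2)).trace.re}ᶜ := by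
    ext U
    simp only [familyGood, Set.mem_setOf_eq, Set.mem_iInter, Set.mem_iUnion, Set.mem_compl_iff,
      not_le, exists_prop]
  rw [hset]
  exact MeasurableSet.iInter fun j => Finset.measurableSet_biUnion _ fun p _ =>
    (StubLargeFieldCountEvent.measurableSet_largeField r ε₀ p).compl

omit [IsTopologicalGroup G] [CompactSpace G] [MeasurableSpace G] [BorelSpace G] in
/-- Family-type good events of cell-carried families are READ ON THE CELL: if every plaquette of
every family of `x` has its sites `y, y + eᵢ, y + eⱼ` labelled `x`, two configurations agreeing on
the links labelled `x` are good on `x` together (`plaquetteHolonomy_congr_of_cell`). -/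
theorem familyGood_local (r : LatticeRep G) (ε₀ : ℝ) {N : ℕ} {μ : Fin 4 → ℕ} {J : ℕ}
    (q : (i : Fin 4) → ZMod N → ZMod (μ i + 1))
    (P : CoarseIdx μ → Fin J → Finset (Plaquette 4 N)) (x : CoarseIdx μ)
    (hP : ∀ j, ∀ p ∈ P x j, siteCell q p.1 = x ∧ siteCell q (p.1.shift p.2.1.1) = x ∧
      siteCell q (p.1.shift p.2.1.2) = x)
    (U V : GaugeConfig 4 N G) (hUV : ∀ e, cellOf q e = x → U e = V e) :
    U ∈ familyGood r ε₀ P x ↔ V ∈ familyGood r ε₀ P x := by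
  simp only [familyGood, Set.mem_setOf_eq]
  refine forall_congr' fun j => exists_congr fun p => and_congr_right fun hp => ?_
  rw [StubLargeFieldCountEvent.plaquetteHolonomy_congr_of_cell q x p (hP j p hp) U V hUV]

/-- Cell-carried families of distinct cells are disjoint (their plaquettes are based in distinct
cells) — the disjointness hypothesis of the union-bound stub (U). -/
theorem disjoint_of_cellFamilies {N : ℕ} {μ : Fin 4 → ℕ} {J : ℕ}
    (q : (i : Fin 4) → ZMod N → ZMod (μ i + 1))
    (P : CoarseIdx μ → Fin J → Finset (Plaquette 4 N))
    (hP : ∀ x j, ∀ p ∈ P x j, siteCell q p.1 = x ∧ siteCell q (p.1.shift p.2.1.1) = x ∧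
      siteCell q (p.1.shift p.2.1.2) = x)
    (x x' : CoarseIdx μ) (j j' : Fin J) (hxx' : x ≠ x') : Disjoint (P x j) (P x' j') := by
  refine Finset.disjoint_left.2 fun p hp hp' => hxx' ?_
  rw [← (hP x j p hp).1, ← (hP x' j' p hp').1]

end Family

/-! ## §3 The physics core in family form and the composition -/

section Core

variable {G : Type} [Group G] [TopologicalSpace G] [IsTopologicalGroup G] [CompactSpace G]
  [MeasurableSpace G] [BorelSpace G]

/-- **The physics core in FAMILY form (`TypicalCoreFamiliesAlongP`)** — statement of the registered
physics stub `stub_typicalCoreFamilies` (open; Sub₁ strength; the only place of the line consuming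
`IsCompactSimpleLieGroup`, `β_k → ∞` and the tuning). As `TypicalCoreAlongP` (cell scale `t ≥ 1`,
radius `n₀`, ratio `γ₀ < 1`, resolutions `α_k > 0` with the polynomial clause, hereditary levels
`ε_k ≥ 0` with `ε_k (1 + A_k) → 0` at the G-blind crude constant `A_k = crudeConst β_k α_k (t·M^{n_k})`,
rough-centre constants `K_s`), except that the good events are of FAMILY TYPE: a threshold `ε₀ > 0`,
family counts `J_k` and family sizes `m_k` with the rate condition
`∀ c > 0, J_k e^{−c β_k m_k} (1 + A_k) → 0`, and on every torus / frame family SOME profile `kp ≥ 0`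
and SOME cell-carried plaquette families `P x j` (`|P x j| ≥ m_k`, every plaquette with its sites
`y, y+eᵢ, y+eⱼ` in the cell `x`) such that, for `good := familyGood r ε₀ P`: the Dobrushin–Shlosman
contraction for shell-good boundary data (`contract`), the received-sum condition (`sum_le`) and
hereditary joint `ε_k`-sparseness of bad cells under the window kernels; plus the rough-centre bound.
Joint sparseness under Wilson's measure, measurability and locality are then free
(`typicalCoreAlongP_of_families`). -/
def TypicalCoreFamiliesAlongP (r : LatticeRep G) (M : ℕ) (sch : SpeciesScheme (YMSpecies G))
    (n : ℕ → ℕ) : Prop :=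
  ∃ (t n₀ : ℕ) (γ₀ ε₀ : ℝ) (α ε : ℕ → ℝ) (K : ℕ → ℝ) (J m : ℕ → ℕ),
    1 ≤ t ∧ 0 ≤ γ₀ ∧ γ₀ < 1 ∧ 0 < ε₀ ∧ (∀ k, 0 < α k) ∧ (∀ k, 0 ≤ ε k) ∧
    Tendsto (fun k => ε k * (1 + crudeConst (sch.β k) (α k) (t * M ^ n k))) atTop (𝓝 0) ∧
    (∀ c : ℝ, 0 < c → Tendsto (fun k => (J k : ℝ) * Real.exp (-(c * sch.β k * m k)) *
        (1 + crudeConst (sch.β k) (α k) (t * M ^ n k))) atTop (𝓝 0)) ∧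
    (∃ (p₀ : ℕ) (K₀ : ℝ), ∀ᶠ k in atTop, |sch.β k| * α k ≤ K₀ * ((sch.a k)⁻¹) ^ p₀) ∧
    ∀ s : ℕ, ∀ᶠ k in atTop, ∀ S : ℕ, sch.L k ≤ S →
      ∀ (μ : Fin 4 → ℕ) (q : (i : Fin 4) → ZMod (2 * S + 1) → ZMod (μ i + 1)),
        (∀ i, 2 * n₀ + 3 ≤ μ i + 1) → (∀ i, IsTorusFrame (2 * S + 1) (t * M ^ n k) (q i)) →
          (∃ (kp : CoarseIdx μ → CoarseIdx μ → CoarseIdx μ → ℝ)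
              (P : CoarseIdx μ → Fin (J k) → Finset (Plaquette 4 (2 * S + 1))),
              (∀ c y x, 0 ≤ kp c y x) ∧
              (∀ (x : CoarseIdx μ) (j : Fin (J k)), ∀ p ∈ P x j, siteCell q p.1 = x ∧
                  siteCell q (p.1.shift p.2.1.1) = x ∧ siteCell q (p.1.shift p.2.1.2) = x) ∧
              (∀ (x : CoarseIdx μ) (j : Fin (J k)), m k ≤ (P x j).card) ∧
              (∀ (c y : CoarseIdx μ), n₀ < cdist c y → ∀ (ω η : GaugeConfig 4 (2 * S + 1) G),
                  (∀ e, cellOf q e ≠ y → ω e = η e) →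
                  (∀ y', cdist c y' = n₀ + 1 →
                    ω ∈ familyGood r ε₀ P y' ∧ η ∈ familyGood r ε₀ P y') →
                  ∀ (f : GaugeConfig 4 (2 * S + 1) G → ℝ) (δ : CoarseIdx μ → ℝ), Measurable f →
                    (∃ B, ∀ U, |f U| ≤ B) → DependsOn f {e | cdist c (cellOf q e) ≤ n₀} →
                    IsCellLipBound (cellOf q) (orbitWeight r (α k) q) f δ →
                      |windowAvg (torusYM r.ρ (sch.β k) (2 * S + 1)) (windowVol (cellOf q) n₀ c) f ω -
                          windowAvg (torusYM r.ρ (sch.β k) (2 * S + 1))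
                            (windowVol (cellOf q) n₀ c) f η| ≤
                        (∑ x ∈ Finset.univ.filter (fun x => cdist c x ≤ n₀), kp c y x * δ x) *
                          orbitWeight r (α k) q y ω η) ∧
              (∀ x : CoarseIdx μ,
                  ∑ c ∈ Finset.univ.filter (fun c => cdist c x ≤ n₀),
                      ∑ y ∈ Finset.univ.filter (fun y => cdist c y = n₀ + 1), kp c y x ≤
                    γ₀ * (Finset.univ.filter (fun c => cdist c x ≤ n₀)).card) ∧
              HereditarySparse (cellOf q) (torusYM r.ρ (sch.β k) (2 * S + 1)) n₀
                (familyGood r ε₀ P) (ε k)) ∧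
          RoughCentreBound r (sch.β k) (2 * S + 1) q (α k) n₀ s (K s)

/-- **Composition (kernel-checked): family core ⇒ physics core** along every scheme with `β_k → ∞`.
The sparseness level of the physics core is `ε'_k := max(ε_k, J_k e^{−c β_k m_k})` with `c = c(ε₀)`
the rate of `largeFieldSparse` (p139523); `ε'_k (1 + A_k) → 0` by the two rate conditions;
`SparseUnder` from the union-bound stub (U) (p140953) on the tori `S ≥ L_k ≥ S₀`, `β_k ≥ b₀`, which
the scheme reaches eventually (`tendsto_L_atTop`); measurability / locality from §2; the physics
clauses pass through, hereditary sparseness by monotonicity in the level. -/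
theorem typicalCoreAlongP_of_families (r : LatticeRep G) {M : ℕ} {sch : SpeciesScheme (YMSpecies G)}
    {n : ℕ → ℕ} (hβ : Tendsto sch.β atTop atTop) (h : TypicalCoreFamiliesAlongP r M sch n) :
    TypicalCoreAlongP r M sch n := by
  obtain ⟨t, n₀, γ₀, ε₀, α, ε, K, J, m, ht, hγ₀, hγ₁, hε₀, hα, hε, hlim, hlimJ, hP, hrest⟩ := h
  obtain ⟨c, b₀, S₀, hc, hLF⟩ := largeFieldSparse G r ε₀ hε₀
  -- the combined sparseness level
  set ε' : ℕ → ℝ := fun k => max (ε k) ((J k : ℝ) * Real.exp (-(c * sch.β k * m k))) with hε'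
  have hJ0 : ∀ k, 0 ≤ (J k : ℝ) * Real.exp (-(c * sch.β k * m k)) := fun k =>
    mul_nonneg (Nat.cast_nonneg _) (Real.exp_pos _).le
  have hε'0 : ∀ k, 0 ≤ ε' k := fun k => (hε k).trans (le_max_left _ _)
  have hA0 : ∀ k, 0 ≤ 1 + crudeConst (sch.β k) (α k) (t * M ^ n k) := fun k =>
    add_nonneg zero_le_one (crudeConst_nonneg _ _ (hα k).le _)
  have hlim' : Tendsto (fun k => ε' k * (1 + crudeConst (sch.β k) (α k) (t * M ^ n k)))
      atTop (𝓝 0) := by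
    have hsum := hlim.add (hlimJ c hc)
    rw [add_zero] at hsum
    refine squeeze_zero (fun k => mul_nonneg (hε'0 k) (hA0 k)) (fun k => ?_) hsum
    have hmax : ε' k ≤ ε k + (J k : ℝ) * Real.exp (-(c * sch.β k * m k)) :=
      max_le (le_add_of_nonneg_right (hJ0 k)) (le_add_of_nonneg_left (hε k))
    calc ε' k * (1 + crudeConst (sch.β k) (α k) (t * M ^ n k))
        ≤ (ε k + (J k : ℝ) * Real.exp (-(c * sch.β k * m k))) *
            (1 + crudeConst (sch.β k) (α k) (t * M ^ n k)) :=
          mul_le_mul_of_nonneg_right hmax (hA0 k)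
      _ = _ := by ring
  refine ⟨t, n₀, γ₀, α, ε', K, ht, hγ₀, hγ₁, hα, hε'0, hlim', hP, fun s => ?_⟩
  filter_upwards [hrest s, hβ.eventually_ge_atTop b₀, hβ.eventually_ge_atTop 0,
    (tendsto_L_atTop sch).eventually_ge_atTop S₀] with k hk hkβ hkβ0 hkL S hS μ q hμ hframe
  obtain ⟨⟨kp, P, hk0, hcell, hcard, hcontract, hsum, hHS⟩, hRC⟩ := hk S hS μ q hμ hframe
  have hcβ : 0 ≤ c * sch.β k := mul_nonneg hc.le hkβ0
  -- joint sparseness under Wilson's measure: large-field sparseness + the union bound (U)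
  have hSU : SparseUnder (wilsonMeasure (d := 4) (L := 2 * S + 1) r.ρ (sch.β k))
      (familyGood r ε₀ P) ((J k : ℝ) * Real.exp (-(c * sch.β k * m k))) :=
    stub_sparseUnderOfLargeField G r ε₀ c (sch.β k) S hcβ (hLF (sch.β k) hkβ S (hkL.trans hS))
      (familyGood r ε₀ P) (J k) (m k) P
      (fun x U hU => (not_mem_familyGood_iff r ε₀ P x U).1 hU) hcard
      (fun x x' j j' hxx' => disjoint_of_cellFamilies q P hcell x x' j j' hxx')
  refine ⟨⟨kp, familyGood r ε₀ P, hk0, fun y => measurableSet_familyGood r ε₀ P y,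
    fun y U V hUV => familyGood_local r ε₀ q P y (hcell y) U V hUV, hcontract, hsum,
    hHS.mono (hε k) (le_max_left _ _), hSU.mono (hJ0 k) (le_max_right _ _)⟩, hRC⟩

end Core

end Summit.QuantumFields.YangMills.Cruxes.LatticeGapOnTrajectory.SparseDefectOrbitWindow

end
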